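import Literature.MathematicalPhysics.QuantumFieldTheory.Balaban1983to89.T3ContinuumYM3Torus
import HarnessLib

/-!
# Route `UnitScaleTilt`, crux K1 child «MinimiserStabilityRegPr» (stmt-QuantumFields-19200), leaf V2′ `stub_halvingStep` — PILLAR F4, PART 8:
# **THE LETTERS OF THE CONSTRAINED PROPAGATOR `G̃ = G − HQG = (1 − HQ)G` OF [Balaban1985Variational] (131)/(143)/(158) FROM THE LETTERS OF
# `G`, `H`, `Q`** — a triangle inequality, typed once over arbitrary finite index types with positive weights (one level or the cube sequence
# (144)), so that pillar F3's menu for the flat `G = Δ_a⁻¹` and `H` (ym3-torus-p1 `FlatPropagatorGradGlobal`, `FlatMinimizerH`) gives the `hG`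
# hypothesis of parts 1/6 (`existsUnique_smallSolution158(W)`) for `G̃` BY NAME

Cell `ym3-torus` (HUMAN RULING D-0037, YM ladder rung R3), seat `ym-ust-19200-f4` gen 0.  `--supports stmt-QuantumFields-19200 --as helper`;
count-neutral; eighth file of pillar F4.  Companion of `…FlatCriticalEquation143.Gt_eq_G_sub_H₀QG` (the identity `G̃ = G − H₀QG` for
`H₀ = GQᵀ(QGQᵀ)⁻¹`, and `rightInverse_eq_H₀`: print's `H` IS `H₀`).

THE PRINT ([Balaban1985Variational], CMP **102** (1985)): p. 298 (131) *«P₀ = I − GQ*(QGQ*)⁻¹Q»*, p. 300 (143) *«GP₀* = G − GQ*(QGQ*)⁻¹QG = G̃»*,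
p. 302: *«all the operators in this section are taken without any external gauge field configuration … These operators were considered in [2,3]»*
— so the sizes of `G̃` ((−3) → (−1), (−2)) follow from those of `G` ([Balaban1984PropagatorsI] (1.115)/(1.110)), of `H` ((46)) and `|Q·| ≤ |·|`.

WHAT IS PROVED (sorry-free; no definition; axioms standard; [folklore] bookkeeping): for finite `ι` (fine), `β` (blocks), a pair structure
`src tgt : κ → ι`, NONNEGATIVE weights `w₀ w₃ : ι → ℝ`, `w₁ : κ → ℝ`, `wB : β → ℝ`, ARBITRARY maps `G : (ι → V) → (ι → V)`, `Q : (ι → V) → (β → V)`,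
`H : (β → V) → (ι → V)` on `V`-valued fields (`V` any normed group):
* **`letters_G_sub_HQG`** — if «`w₃|f| ≤ t` ⇒ `w₀|Gf| ≤ B_G t ∧ w₁|∇Gf| ≤ B_G′ t`», «`w₀|y| ≤ r` ⇒ `wB|Qy| ≤ C_Q r`», «`wB|X| ≤ s` ⇒ `w₀|HX| ≤ B_H s ∧
  w₁|∇HX| ≤ B_H′ s`», then `G̃f := Gf − H(Q(Gf))` obeys `w₀|G̃f| ≤ (B_G + B_H C_Q B_G)·t` and `w₁|∇G̃f| ≤ (B_G′ + B_H′ C_Q B_G)·t` — the `hG` shape of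
  `FlatSmallSolution158Levels.existsUnique_smallSolution158W` for `G̃` with `B₀ = max` of the two.
* `Q_G_sub_HQG` — for additive `Q` with `Q(HX) = X`: `Q(G̃f) = 0` (*«Q𝔊 = 0»*).
* **`letters_G_sub_HQG_T3`** — the one-level d = 3 carrier instance (`ι = PBond (F.P K) 0`, pairs `(s, μ, ν)`, `w₀ = w₃ = wB = 1`, `w₁ = L^{K−n}`) in the
  exact letter shape of `FlatScalarExtension.exists_extension_T3` / `FlatSmallSolution158.existsUnique_smallSolution158_T3`.
HONEST SCOPE.  Pure triangle inequalities; which `G`, `H`, `Q` are fed (one-level menu, or the admissible-sequence operators of [Balaban1984PropagatorsII]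
for the cube sequence) is the composition's; NOT a claim about the mass gap.

References: T. Bałaban, CMP **102** (1985) 277–309 [Balaban1985Variational] (131) p.298, (143) p.300, (158) p.302, (46) p.285.
-/

set_option autoImplicit false

noncomputable section

namespace Summit.QuantumFields.YangMills.Theorems.FlatConstrainedPropagatorLetters

open Literature.MathematicalPhysics.QuantumFieldTheory.Balaban1983to89

section Generic

variable {ι κ β : Type*} {V : Type*} [NormedAddCommGroup V]

/-- **LETTERS OF `G̃ = G − HQG` FROM THOSE OF `G`, `H`, `Q`** (weighted sizes on arbitrary index types; a triangle inequality): with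
`w₃|f| ≤ t ⇒ (w₀|Gf| ≤ B_G t, w₁|∇Gf| ≤ B_G′ t)`, `w₀|y| ≤ r ⇒ wB|Qy| ≤ C_Q r`, `wB|X| ≤ s ⇒ (w₀|HX| ≤ B_H s, w₁|∇HX| ≤ B_H′ s)`:
`w₀|G̃f| ≤ (B_G + B_H C_Q B_G) t` and `w₁|∇G̃f| ≤ (B_G′ + B_H′ C_Q B_G) t`. [cite: Balaban1985Variational, (143) p.300, (131) p.298] -/
theorem letters_G_sub_HQG (src tgt : κ → ι) {w₀ w₃ : ι → ℝ} {w₁ : κ → ℝ} {wB : β → ℝ}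
    (hw₀ : ∀ i, 0 ≤ w₀ i) (hw₁ : ∀ p, 0 ≤ w₁ p)
    (G : (ι → V) → (ι → V)) (Q : (ι → V) → (β → V)) (H : (β → V) → (ι → V)) {BG BG' CQ BH BH' : ℝ}
    (hG : ∀ (f : ι → V) (t : ℝ), (∀ i, w₃ i * ‖f i‖ ≤ t) →
      (∀ i, w₀ i * ‖G f i‖ ≤ BG * t) ∧ ∀ p, w₁ p * ‖G f (tgt p) - G f (src p)‖ ≤ BG' * t)
    (hQ : ∀ (y : ι → V) (r : ℝ), (∀ i, w₀ i * ‖y i‖ ≤ r) → ∀ c, wB c * ‖Q y c‖ ≤ CQ * r)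
    (hH : ∀ (X : β → V) (s : ℝ), (∀ c, wB c * ‖X c‖ ≤ s) →
      (∀ i, w₀ i * ‖H X i‖ ≤ BH * s) ∧ ∀ p, w₁ p * ‖H X (tgt p) - H X (src p)‖ ≤ BH' * s)
    (f : ι → V) (t : ℝ) (hf : ∀ i, w₃ i * ‖f i‖ ≤ t) :
    (∀ i, w₀ i * ‖(G f - H (Q (G f))) i‖ ≤ (BG + BH * CQ * BG) * t) ∧
      ∀ p, w₁ p * ‖(G f - H (Q (G f))) (tgt p) - (G f - H (Q (G f))) (src p)‖ ≤ (BG' + BH' * CQ * BG) * t := by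
  obtain ⟨hG0, hG1⟩ := hG f t hf
  have hQG : ∀ c, wB c * ‖Q (G f) c‖ ≤ CQ * (BG * t) := hQ (G f) (BG * t) hG0
  obtain ⟨hH0, hH1⟩ := hH (Q (G f)) (CQ * (BG * t)) hQG
  refine ⟨fun i => ?_, fun p => ?_⟩
  · calc w₀ i * ‖(G f - H (Q (G f))) i‖ ≤ w₀ i * (‖G f i‖ + ‖H (Q (G f)) i‖) :=
          mul_le_mul_of_nonneg_left (norm_sub_le _ _) (hw₀ i)
      _ = w₀ i * ‖G f i‖ + w₀ i * ‖H (Q (G f)) i‖ := mul_add _ _ _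
      _ ≤ BG * t + BH * (CQ * (BG * t)) := add_le_add (hG0 i) (hH0 i)
      _ = (BG + BH * CQ * BG) * t := by ring
  · have e : (G f - H (Q (G f))) (tgt p) - (G f - H (Q (G f))) (src p) =
        (G f (tgt p) - G f (src p)) - (H (Q (G f)) (tgt p) - H (Q (G f)) (src p)) := by
      simp only [Pi.sub_apply]; abel
    rw [e]
    calc w₁ p * ‖(G f (tgt p) - G f (src p)) - (H (Q (G f)) (tgt p) - H (Q (G f)) (src p))‖
        ≤ w₁ p * (‖G f (tgt p) - G f (src p)‖ + ‖H (Q (G f)) (tgt p) - H (Q (G f)) (src p)‖) :=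
          mul_le_mul_of_nonneg_left (norm_sub_le _ _) (hw₁ p)
      _ = w₁ p * ‖G f (tgt p) - G f (src p)‖ + w₁ p * ‖H (Q (G f)) (tgt p) - H (Q (G f)) (src p)‖ := mul_add _ _ _
      _ ≤ BG' * t + BH' * (CQ * (BG * t)) := add_le_add (hG1 p) (hH1 p)
      _ = (BG' + BH' * CQ * BG) * t := by ring

/-- **«Q𝔊 = 0» for `G̃ = G − HQG`**: an additive `Q` with `Q(HX) = X` annihilates `Gf − H(Q(Gf))`. [cite: Balaban1985Variational, (143) p.300, (45) p.285] -/
theorem Q_G_sub_HQG {X' : Type*} [AddCommGroup X'] (G : (ι → V) → (ι → V)) (Q : (ι → V) →+ X') (H : X' → (ι → V))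
    (hQH : ∀ X, Q (H X) = X) (f : ι → V) : Q (G f - H (Q (G f))) = 0 := by
  rw [map_sub, hQH, sub_self]

end Generic

/-! ## The one-level d = 3 carrier instance (letters of `FlatScalarExtension.exists_extension_T3`) -/

section T3

open T3ContinuumYM3Torus (T3Family)

variable {V : Type*} [NormedAddCommGroup V]

/-- **`G̃ = G − HQG` AT THE ONE-LEVEL d = 3 CARRIER** (fine bonds `PBond (F.P K) 0`, blocks `PBond (F.P K) (K − n)`, weights `1` and `L^{K−n}` on the
forward difference): from p1 g14/g15's letters for `G` (`|Gf| ≤ B_G β`, `L^{K−n}|∇Gf| ≤ B_G′ β` for `|f| ≤ β`), `H` (`|HX| ≤ B_H s`, `L^{K−n}|∇HX| ≤ B_H′ s`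
for `|X| ≤ s`) and `|Qy| ≤ C_Q·sup|y|`, the constrained `G̃f := Gf − H(Q(Gf))` has `|G̃f| ≤ (B_G + B_H C_Q B_G)β` and `L^{K−n}|∇G̃f| ≤ (B_G′ + B_H′ C_Q B_G)β`
— the `hG` letters of `existsUnique_smallSolution158_T3` / `exists_extension_T3`. [cite: Balaban1985Variational, (143) p.300, (158) p.302] -/
theorem letters_G_sub_HQG_T3 (F : T3Family) (n K : ℕ)
    (G : (PBond (F.P K) 0 → V) → (PBond (F.P K) 0 → V)) (Q : (PBond (F.P K) 0 → V) → (PBond (F.P K) (K - n) → V))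
    (H : (PBond (F.P K) (K - n) → V) → (PBond (F.P K) 0 → V)) {BG BG' CQ BH BH' : ℝ}
    (hG : ∀ (f : PBond (F.P K) 0 → V) (t : ℝ), (∀ b, ‖f b‖ ≤ t) →
      (∀ b, ‖G f b‖ ≤ BG * t) ∧
        ∀ (s : Site (F.P K) 0) (μ ν : Fin 3), (F.L : ℝ) ^ (K - n) * ‖G f ⟨s.shift ν, μ⟩ - G f ⟨s, μ⟩‖ ≤ BG' * t)
    (hQ : ∀ (y : PBond (F.P K) 0 → V) (r : ℝ), (∀ b, ‖y b‖ ≤ r) → ∀ c, ‖Q y c‖ ≤ CQ * r)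
    (hH : ∀ (X : PBond (F.P K) (K - n) → V) (s : ℝ), (∀ c, ‖X c‖ ≤ s) →
      (∀ b, ‖H X b‖ ≤ BH * s) ∧
        ∀ (s' : Site (F.P K) 0) (μ ν : Fin 3), (F.L : ℝ) ^ (K - n) * ‖H X ⟨s'.shift ν, μ⟩ - H X ⟨s', μ⟩‖ ≤ BH' * s)
    (f : PBond (F.P K) 0 → V) (t : ℝ) (hf : ∀ b, ‖f b‖ ≤ t) :
    (∀ b, ‖(G f - H (Q (G f))) b‖ ≤ (BG + BH * CQ * BG) * t) ∧
      ∀ (s : Site (F.P K) 0) (μ ν : Fin 3),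
        (F.L : ℝ) ^ (K - n) * ‖(G f - H (Q (G f))) ⟨s.shift ν, μ⟩ - (G f - H (Q (G f))) ⟨s, μ⟩‖ ≤ (BG' + BH' * CQ * BG) * t := by
  -- the pair structure: κ = Site × (μ, ν), src (s, μ, ν) = ⟨s, μ⟩, tgt (s, μ, ν) = ⟨s + e_ν, μ⟩; weights 1, L^{K−n}, 1, 1
  have hL : (0 : ℝ) ≤ (F.L : ℝ) ^ (K - n) := pow_nonneg (Nat.cast_nonneg _) _
  have h := letters_G_sub_HQG (ι := PBond (F.P K) 0) (κ := Site (F.P K) 0 × Fin 3 × Fin 3) (β := PBond (F.P K) (K - n))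
    (fun q => (⟨q.1, q.2.1⟩ : PBond (F.P K) 0)) (fun q => (⟨q.1.shift q.2.2, q.2.1⟩ : PBond (F.P K) 0))
    (w₀ := fun _ => (1 : ℝ)) (w₃ := fun _ => (1 : ℝ)) (w₁ := fun _ => (F.L : ℝ) ^ (K - n)) (wB := fun _ => (1 : ℝ))
    (fun _ => zero_le_one) (fun _ => hL) G Q H (BG := BG) (BG' := BG') (CQ := CQ) (BH := BH) (BH' := BH')
    (fun f' t' hf' => by
      obtain ⟨h0, h1⟩ := hG f' t' (fun b => by simpa using hf' b)
      exact ⟨fun b => by simpa using h0 b, fun q => h1 q.1 q.2.1 q.2.2⟩)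
    (fun y r hy c => by simpa using hQ y r (fun b => by simpa using hy b) c)
    (fun X s hX => by
      obtain ⟨h0, h1⟩ := hH X s (fun c => by simpa using hX c)
      exact ⟨fun b => by simpa using h0 b, fun q => h1 q.1 q.2.1 q.2.2⟩)
    f t (fun b => by simpa using hf b)
  exact ⟨fun b => by simpa using h.1 b, fun s μ ν => h.2 (s, μ, ν)⟩

end T3

end Summit.QuantumFields.YangMills.Theorems.FlatConstrainedPropagatorLetters

end
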